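import Summits.QuantumAdvantage.Dequantization.GraphStateRotationActiveGraph
import Mathlib.Combinatorics.SimpleGraph.Connectivity.Finite
import HarnessLib

/-!
# The output law of the `CZ` + `Z`-rotation circuits of arXiv:2509.09033 factorises over the
# connected components of the graph (DEQ-E25, Lemma E25-1, component clause)

HONEST FRAMING: instance-level adjudication of specific advantage claims; no claim about BQP vs
BPP or the summit.

Continuation of `GraphStateRotationCorrelators` / `…Marginals` / `…Inputs` / `…ActiveGraph`
(same namespace; source arXiv:2509.09033v1, Definition 16 / Algorithm 1, convention
`RZ(θ) = e^{-iθZ}`).  Call a wire set `T` CLOSED in `G` when every `G`-neighbour of a wire of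
`T` lies in `T` (hypothesis `∀ ⦃a b⦄, a ∈ T → G.Adj a b → b ∈ T`; equivalently `T` is a union
of connected components of `G`).  From the closed form `correlator_eq_prod` we derive:
* `correlator_union_of_closed` — for `S₁ ⊆ T` and `S₂` disjoint from a closed `T`,
  `E[χ_{S₁ ∪ S₂}] = E[χ_{S₁}] · E[χ_{S₂}]` (the edge count and every wire factor split);
* `margProb_union_of_closed` — INDEPENDENCE: for `T₂` disjoint from a closed `T`,
  `Pr[y|_{T ∪ T₂} = v|_{T ∪ T₂}] = Pr[y|_T = v|_T] · Pr[y|_{T₂} = v|_{T₂}]`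
  (Walsh inversion `margProb_eq_sum_correlator` on the two sub-cubes);
* `prob_eq_margProb_mul_margProb_sdiff` — `p(y) = Pr[y|_T = y|_T] · Pr[y|_{Tᶜ} = y|_{Tᶜ}]`;
* `margProb_biUnion_of_closed`, `prob_eq_prod_margProb_of_closed` — the same for any family
  of pairwise disjoint closed parts, and
  `prob_eq_prod_components` — **`p(y) = ∏_C Pr[y|_C = y|_C]` over the connected components
  `C` of `G`**; by `margProb_local` (marginals module) each factor is the output law of the
  circuit on `G[C]` with the angles `θ|_C`;
* `probX_eq_prod_margProb_activeGraph`, `probX_eq_prod_components_activeGraph` — general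
  input `x ∈ {0,1}^n` (`|+⟩` on `x_a = 0`, `|0⟩` on `x_a = 1`):
  `p(y|x) = 2^{|A_x| - n} ∏_C Pr^{G_x}[y|_C = y|_C]` over the ACTIVE CLUSTERS `C` (the
  connected components of the active graph `G_x` cut down to the active wires `A_x`).
This is the clause 'p_H factorises further over the connected components of H' of Lemma E25-1
in the unit note `pub-qadeq-deq-2/DEQ-E25.md` §2 (recorded there as NOT formalised through
v1.6a); it is what makes exact classical sampling of `p(·|x)` cost `Σ_C 2^{|C|}·|C|`
correlator evaluations over the active clusters (Lemma E25-3).  Nothing here concerns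
sampling hardness of the full distribution at `x = 0^n`.  No `sorry`, standard axioms.
-/

noncomputable section

namespace Summit.QuantumAdvantage.Dequantization.GraphStateRotationCorrelators

open Finset
open Literature.Probability.RandomGraphs.LowDegree (walsh)
open Literature.Computability.Cryptography (QReg)

variable {n : ℕ} (G : SimpleGraph (Fin n)) [DecidableRel G.Adj] (θ : Fin n → ℝ)

/-! ### Splitting of the neighbour counts, the wire factors and the edge count -/

/-- `m_a(S₁ ⊔ S₂) = m_a(S₁) + m_a(S₂)`. -/
theorem nbrIn_union {S₁ S₂ : Finset (Fin n)} (h : Disjoint S₁ S₂) (a : Fin n) :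
    nbrIn G (S₁ ∪ S₂) a = nbrIn G S₁ a + nbrIn G S₂ a := by
  unfold nbrIn
  rw [← card_union_of_disjoint]
  · congr 1
    ext b
    simp only [mem_filter, mem_univ, true_and, mem_union]
    constructor
    · rintro ⟨hab, h1 | h2⟩
      · exact Or.inl ⟨hab, h1⟩
      · exact Or.inr ⟨hab, h2⟩
    · rintro (⟨hab, h1⟩ | ⟨hab, h2⟩)
      · exact ⟨hab, Or.inl h1⟩
      · exact ⟨hab, Or.inr h2⟩
  · exact disjoint_filter.2 fun b _ h1 h2 => disjoint_left.1 h h1.2 h2.2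

/-- A wire of a closed set `T` has no neighbours outside `T`. -/
theorem nbrIn_eq_zero_of_mem_closed {T S : Finset (Fin n)}
    (hT : ∀ ⦃a b⦄, a ∈ T → G.Adj a b → b ∈ T) {a : Fin n} (ha : a ∈ T)
    (hS : ∀ b ∈ S, b ∉ T) : nbrIn G S a = 0 := by
  unfold nbrIn
  rw [card_eq_zero, filter_eq_empty_iff]
  rintro b - ⟨hab, hb⟩
  exact hS b hb (hT ha hab)

/-- A wire outside a closed set `T` has no neighbours inside `T`. -/
theorem nbrIn_eq_zero_of_not_mem_closed {T S : Finset (Fin n)}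
    (hT : ∀ ⦃a b⦄, a ∈ T → G.Adj a b → b ∈ T) {a : Fin n} (ha : a ∉ T) (hS : S ⊆ T) :
    nbrIn G S a = 0 := by
  unfold nbrIn
  rw [card_eq_zero, filter_eq_empty_iff]
  rintro b - ⟨hab, hb⟩
  exact ha (hT (hS hb) hab.symm)

/-- A wire outside `S` with no neighbour in `S` contributes the factor `1`. -/
theorem wire_eq_one_of_nbrIn_eq_zero {S : Finset (Fin n)} {a : Fin n} (ha : a ∉ S)
    (h0 : nbrIn G S a = 0) : wire G θ S a = 1 := by
  simp [wire, ha, h0]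

/-- The wire factor of `a` sees `S` only through `[a ∈ S]` and `m_a(S)`. -/
theorem wire_congr_set {S S' : Finset (Fin n)} {a : Fin n} (hmem : (a ∈ S ↔ a ∈ S'))
    (hn : nbrIn G S a = nbrIn G S' a) : wire G θ S a = wire G θ S' a := by
  unfold wire
  rw [hn]
  by_cases h : a ∈ S
  · rw [if_pos h, if_pos (hmem.1 h)]
  · rw [if_neg h, if_neg fun h' => h (hmem.2 h')]

/-- Across a closed set the wire factors split, `wire_a(S₁ ∪ S₂) = wire_a(S₁) · wire_a(S₂)`
for `S₁ ⊆ T` and `S₂ ∩ T = ∅` (for every `a` one of the two factors is `1`). -/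
theorem wire_union_of_closed {T S₁ S₂ : Finset (Fin n)}
    (hT : ∀ ⦃a b⦄, a ∈ T → G.Adj a b → b ∈ T) (h₁ : S₁ ⊆ T) (h₂ : ∀ b ∈ S₂, b ∉ T)
    (a : Fin n) : wire G θ (S₁ ∪ S₂) a = wire G θ S₁ a * wire G θ S₂ a := by
  have hdisj : Disjoint S₁ S₂ := disjoint_left.2 fun b hb1 hb2 => h₂ b hb2 (h₁ hb1)
  by_cases ha : a ∈ T
  · have h2a : a ∉ S₂ := fun h => h₂ a h ha
    have hz : nbrIn G S₂ a = 0 := nbrIn_eq_zero_of_mem_closed G hT ha h₂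
    rw [wire_eq_one_of_nbrIn_eq_zero G θ h2a hz, mul_one]
    refine wire_congr_set G θ ?_ ?_
    · rw [mem_union]
      exact ⟨fun h => h.resolve_right h2a, Or.inl⟩
    · rw [nbrIn_union G hdisj, hz, add_zero]
  · have h1a : a ∉ S₁ := fun h => ha (h₁ h)
    have hz : nbrIn G S₁ a = 0 := nbrIn_eq_zero_of_not_mem_closed G hT ha h₁
    rw [wire_eq_one_of_nbrIn_eq_zero G θ h1a hz, one_mul]
    refine wire_congr_set G θ ?_ ?_
    · rw [mem_union]
      exact ⟨fun h => h.resolve_left h1a, Or.inr⟩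
    · rw [nbrIn_union G hdisj, hz, zero_add]

/-- Across a closed set the edge count splits: `e_G(S₁ ∪ S₂) = e_G(S₁) + e_G(S₂)`. -/
theorem edgesIn_union_of_closed {T S₁ S₂ : Finset (Fin n)}
    (hT : ∀ ⦃a b⦄, a ∈ T → G.Adj a b → b ∈ T) (h₁ : S₁ ⊆ T) (h₂ : ∀ b ∈ S₂, b ∉ T) :
    edgesIn G (S₁ ∪ S₂) = edgesIn G S₁ + edgesIn G S₂ := by
  unfold edgesIn
  rw [← card_union_of_disjoint]
  · congr 1
    ext p
    simp only [mem_filter, mem_univ, true_and, mem_union]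
    constructor
    · rintro ⟨hlt, hadj, hp1 | hp1, hp2 | hp2⟩
      · exact Or.inl ⟨hlt, hadj, hp1, hp2⟩
      · exact absurd (hT (h₁ hp1) hadj) (h₂ _ hp2)
      · exact absurd (hT (h₁ hp2) hadj.symm) (h₂ _ hp1)
      · exact Or.inr ⟨hlt, hadj, hp1, hp2⟩
    · rintro (⟨hlt, hadj, hp1, hp2⟩ | ⟨hlt, hadj, hp1, hp2⟩)
      · exact ⟨hlt, hadj, Or.inl hp1, Or.inl hp2⟩
      · exact ⟨hlt, hadj, Or.inr hp1, Or.inr hp2⟩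
  · refine disjoint_filter.2 ?_
    rintro p - ⟨-, -, hp1, -⟩ ⟨-, -, hp1', -⟩
    exact h₂ _ hp1' (h₁ hp1)

/-! ### Factorisation of the correlators and independence of the marginals -/

/-- **Correlators factorise across a closed wire set**: for `S₁ ⊆ T` and `S₂` disjoint from a
closed `T`, `E[χ_{S₁ ∪ S₂}] = E[χ_{S₁}] · E[χ_{S₂}]`. -/
theorem correlator_union_of_closed {T S₁ S₂ : Finset (Fin n)}
    (hT : ∀ ⦃a b⦄, a ∈ T → G.Adj a b → b ∈ T) (h₁ : S₁ ⊆ T) (h₂ : ∀ b ∈ S₂, b ∉ T) :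
    correlator G θ (S₁ ∪ S₂) = correlator G θ S₁ * correlator G θ S₂ := by
  have e := correlator_eq_prod G θ (S₁ ∪ S₂)
  rw [edgesIn_union_of_closed G hT h₁ h₂, pow_add,
    Finset.prod_congr rfl (fun a _ => wire_union_of_closed G θ hT h₁ h₂ a),
    Finset.prod_mul_distrib,
    show ∀ A B C D : ℂ, A * B * (C * D) = (A * C) * (B * D) from fun A B C D => by ring,
    ← correlator_eq_prod G θ S₁, ← correlator_eq_prod G θ S₂] at e
  exact_mod_cast e

/-- `χ_{S₁ ⊔ S₂} = χ_{S₁} · χ_{S₂}`. -/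
theorem walsh_union {S₁ S₂ : Finset (Fin n)} (h : Disjoint S₁ S₂) (y : QReg n) :
    walsh (S₁ ∪ S₂) y = walsh S₁ y * walsh S₂ y := by
  rw [walsh, walsh, walsh, Finset.prod_union h]

/-- Subsets of a disjoint union correspond to pairs of subsets (`S ↦ (S ∩ T₁, S ∩ T₂)`), so a
sum over `𝒫(T₁ ∪ T₂)` is an iterated sum. [folklore] -/
theorem sum_powerset_union {M : Type*} [AddCommMonoid M] {T₁ T₂ : Finset (Fin n)}
    (h : Disjoint T₁ T₂) (f : Finset (Fin n) → M) :
    ∑ S ∈ (T₁ ∪ T₂).powerset, f S =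
      ∑ S₁ ∈ T₁.powerset, ∑ S₂ ∈ T₂.powerset, f (S₁ ∪ S₂) := by
  rw [← sum_product']
  refine sum_nbij' (fun S => (S ∩ T₁, S ∩ T₂)) (fun p => p.1 ∪ p.2) ?_ ?_ ?_ ?_ ?_
  · intro S _
    simp only [mem_product, mem_powerset]
    exact ⟨inter_subset_right, inter_subset_right⟩
  · rintro ⟨S₁, S₂⟩ hp
    simp only [mem_product, mem_powerset] at hp ⊢
    exact union_subset_union hp.1 hp.2
  · intro S hS
    rw [mem_powerset] at hS
    change S ∩ T₁ ∪ S ∩ T₂ = S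
    rw [← inter_union_distrib_left, inter_eq_left.2 hS]
  · rintro ⟨S₁, S₂⟩ hp
    simp only [mem_product, mem_powerset] at hp
    have h1 : S₂ ∩ T₁ = ∅ := disjoint_iff_inter_eq_empty.1 (h.symm.mono_left hp.2)
    have h2 : S₁ ∩ T₂ = ∅ := disjoint_iff_inter_eq_empty.1 (h.mono_left hp.1)
    change ((S₁ ∪ S₂) ∩ T₁, (S₁ ∪ S₂) ∩ T₂) = (S₁, S₂)
    rw [union_inter_distrib_right, union_inter_distrib_right, h1, h2, union_empty,
      empty_union, inter_eq_left.2 hp.1, inter_eq_left.2 hp.2]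
  · intro S hS
    rw [mem_powerset] at hS
    change f S = f (S ∩ T₁ ∪ S ∩ T₂)
    rw [← inter_union_distrib_left, inter_eq_left.2 hS]

/-- **Independence across a closed wire set (Lemma E25-1, component clause).**  For a closed
`T` and any `T₂` disjoint from it the restrictions `y|_T`, `y|_{T₂}` of the output are
independent: `Pr[y|_{T ∪ T₂} = v|_{T ∪ T₂}] = Pr[y|_T = v|_T] · Pr[y|_{T₂} = v|_{T₂}]`.
[DEQ-E25 §2, Lemma E25-1; derived here from arXiv:2509.09033v1 Def. 16] -/
theorem margProb_union_of_closed {T T₂ : Finset (Fin n)}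
    (hT : ∀ ⦃a b⦄, a ∈ T → G.Adj a b → b ∈ T) (h₂ : ∀ b ∈ T₂, b ∉ T) (v : QReg n) :
    margProb G θ (T ∪ T₂) v = margProb G θ T v * margProb G θ T₂ v := by
  have hdisj : Disjoint T T₂ := disjoint_left.2 fun b hb1 hb2 => h₂ b hb2 hb1
  rw [margProb_eq_sum_correlator, margProb_eq_sum_correlator, margProb_eq_sum_correlator,
    card_union_of_disjoint hdisj, pow_add, div_mul_div_comm, sum_powerset_union hdisj,
    sum_mul_sum]
  congr 1
  refine Finset.sum_congr rfl fun S₁ hS₁ => Finset.sum_congr rfl fun S₂ hS₂ => ?_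
  rw [mem_powerset] at hS₁ hS₂
  rw [correlator_union_of_closed G θ hT hS₁ (fun b hb => h₂ b (hS₂ hb)),
    walsh_union (hdisj.mono hS₁ hS₂)]
  ring

/-- The marginal on all wires is the law itself. -/
theorem margProb_univ (v : QReg n) : margProb G θ univ v = prob G θ v := by
  have hs : univ.filter (fun y : QReg n => ∀ a ∈ (univ : Finset (Fin n)), y a = v a) = {v} := by
    ext y
    simp [funext_iff]
  unfold margProb
  rw [hs, Finset.sum_singleton]

/-- The marginal on no wires is `1`. -/
theorem margProb_empty (v : QReg n) : margProb G θ ∅ v = 1 := by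
  unfold margProb
  rw [Finset.filter_true_of_mem (fun y _ => by simp), sum_prob]

/-- **`p(y) = Pr[y|_T = y|_T] · Pr[y|_{Tᶜ} = y|_{Tᶜ}]` for a closed wire set `T`.** -/
theorem prob_eq_margProb_mul_margProb_sdiff {T : Finset (Fin n)}
    (hT : ∀ ⦃a b⦄, a ∈ T → G.Adj a b → b ∈ T) (y : QReg n) :
    prob G θ y = margProb G θ T y * margProb G θ (univ \ T) y := by
  rw [← margProb_univ,
    ← margProb_union_of_closed G θ hT (fun b (hb : b ∈ univ \ T) => (mem_sdiff.1 hb).2),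
    union_sdiff_of_subset (subset_univ T)]

/-- **Factorisation over pairwise disjoint closed parts** (e.g. connected components):
`Pr[y|_{⋃_{i ∈ I} P_i} = v|_{⋃ P_i}] = ∏_{i ∈ I} Pr[y|_{P_i} = v|_{P_i}]`. -/
theorem margProb_biUnion_of_closed {ι : Type*} (I : Finset ι) (P : ι → Finset (Fin n))
    (hclosed : ∀ i ∈ I, ∀ ⦃a b⦄, a ∈ P i → G.Adj a b → b ∈ P i)
    (hdisj : ∀ i ∈ I, ∀ j ∈ I, i ≠ j → Disjoint (P i) (P j)) (v : QReg n) :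
    margProb G θ (I.biUnion P) v = ∏ i ∈ I, margProb G θ (P i) v := by
  induction I using Finset.cons_induction with
  | empty => rw [Finset.biUnion_empty, Finset.prod_empty, margProb_empty]
  | cons j I hj ih =>
    classical
    have hI : ∀ i ∈ I, i ∈ cons j I hj := fun i hi => Finset.mem_cons_of_mem hi
    have hjI : j ∈ cons j I hj := Finset.mem_cons_self j I
    have h₂ : ∀ b ∈ I.biUnion P, b ∉ P j := by
      intro b hb hbj
      obtain ⟨i, hi, hbi⟩ := Finset.mem_biUnion.1 hb
      have hne : j ≠ i := by
        rintro rfl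
        exact hj hi
      exact disjoint_left.1 (hdisj j hjI i (hI i hi) hne) hbj hbi
    rw [Finset.cons_eq_insert, Finset.biUnion_insert, Finset.prod_insert hj,
      margProb_union_of_closed G θ (hclosed j hjI) h₂ v,
      ih (fun i hi => hclosed i (hI i hi))
        (fun i hi i' hi' hne => hdisj i (hI i hi) i' (hI i' hi') hne)]

/-- **Lemma E25-1, component clause, abstract form (input `x = 0^n`).**  If the wires are
covered by pairwise disjoint closed parts `P_i`, then `p(y) = ∏_i Pr[y|_{P_i} = y|_{P_i}]`;
by `margProb_local` each factor is the output law of the circuit on `G[P_i]` with the angles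
`θ|_{P_i}`. [DEQ-E25 §2, Lemma E25-1; derived here from arXiv:2509.09033v1 Def. 16] -/
theorem prob_eq_prod_margProb_of_closed {ι : Type*} (I : Finset ι) (P : ι → Finset (Fin n))
    (hclosed : ∀ i ∈ I, ∀ ⦃a b⦄, a ∈ P i → G.Adj a b → b ∈ P i)
    (hdisj : ∀ i ∈ I, ∀ j ∈ I, i ≠ j → Disjoint (P i) (P j)) (hcover : I.biUnion P = univ)
    (y : QReg n) : prob G θ y = ∏ i ∈ I, margProb G θ (P i) y := by
  rw [← margProb_univ, ← hcover]
  exact margProb_biUnion_of_closed G θ I P hclosed hdisj y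

/-- **Lemma E25-1, component clause (input `x = 0^n`): the output law is the product of its
marginals on the connected components of `G`**, `p(y) = ∏_C Pr[y|_C = y|_C]`.
[DEQ-E25 §2, Lemma E25-1; derived here from arXiv:2509.09033v1 Def. 16] -/
theorem prob_eq_prod_components (y : QReg n) :
    prob G θ y =
      ∏ c : G.ConnectedComponent, margProb G θ (univ.filter fun a => a ∈ c.supp) y := by
  refine prob_eq_prod_margProb_of_closed G θ (univ : Finset G.ConnectedComponent)
    (fun c : G.ConnectedComponent => univ.filter fun a : Fin n => a ∈ c.supp) ?_ ?_ ?_ y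
  · intro c _ a b ha hab
    rw [mem_filter] at ha ⊢
    exact ⟨mem_univ b, (c.mem_supp_congr_adj hab).1 ha.2⟩
  · intro c _ c' _ hne
    refine disjoint_left.2 fun a ha ha' => hne ?_
    rw [mem_filter, SimpleGraph.ConnectedComponent.mem_supp_iff] at ha ha'
    exact ha.2.symm.trans ha'.2
  · ext a
    simp only [mem_biUnion, mem_univ, true_and, mem_filter, iff_true]
    exact ⟨G.connectedComponentMk a, rfl⟩

/-! ### General input `x`: factorisation over the active clusters -/

omit [DecidableRel G.Adj] in
/-- In the active graph `G_x` every inactive wire is isolated, so a wire set containing every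
ACTIVE `G`-neighbour of each of its wires is closed in `G_x`. -/
theorem closed_activeGraph {x : QReg n} {C : Finset (Fin n)}
    (h : ∀ ⦃a b⦄, a ∈ C → b ∈ active x → G.Adj a b → b ∈ C) :
    ∀ ⦃a b⦄, a ∈ C → (activeGraph G x).Adj a b → b ∈ C :=
  fun _ _ ha hab =>
    h ha (mem_active.2 ((activeGraph_adj G).1 hab).2.2) ((activeGraph_adj G).1 hab).1

/-- **Lemma E25-1 with its component clause, general input `x`, abstract form.**  For any
partition of the active wires `A_x` into parts `P_i` closed in the active graph `G_x`,
`p(y|x) = (∏_i Pr^{G_x}[y|_{P_i} = y|_{P_i}]) · 2^{|A_x|} / 2^n`: independent circuits on the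
parts times independent fair coins on the `n - |A_x|` inactive wires.
[DEQ-E25 §2, Lemma E25-1; derived here from arXiv:2509.09033v1 Def. 16] -/
theorem probX_eq_prod_margProb_activeGraph {ι : Type*} (x y : QReg n) (I : Finset ι)
    (P : ι → Finset (Fin n))
    (hclosed : ∀ i ∈ I, ∀ ⦃a b⦄, a ∈ P i → (activeGraph G x).Adj a b → b ∈ P i)
    (hdisj : ∀ i ∈ I, ∀ j ∈ I, i ≠ j → Disjoint (P i) (P j))
    (hcover : I.biUnion P = active x) :
    probX G θ x y =
      (∏ i ∈ I, margProb (activeGraph G x) θ (P i) y) * 2 ^ (active x).card / 2 ^ n := by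
  rw [probX_eq_margProb_activeGraph, ← hcover,
    margProb_biUnion_of_closed (activeGraph G x) θ I P hclosed hdisj y]

/-- **Lemma E25-1 with its component clause, general input `x`: `p(y|x)` is `2^{|A_x| - n}`
times the product, over the ACTIVE CLUSTERS `C` (the connected components of `G_x` cut down to
the active wires), of the marginals `Pr^{G_x}[y|_C = y|_C]`.**
[DEQ-E25 §2, Lemma E25-1; derived here from arXiv:2509.09033v1 Def. 16] -/
theorem probX_eq_prod_components_activeGraph (x y : QReg n) :
    probX G θ x y =
      (∏ c : (activeGraph G x).ConnectedComponent,
          margProb (activeGraph G x) θ (univ.filter fun a => a ∈ c.supp ∧ a ∈ active x) y) *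
        2 ^ (active x).card / 2 ^ n := by
  refine probX_eq_prod_margProb_activeGraph G θ x y
    (univ : Finset (activeGraph G x).ConnectedComponent)
    (fun c : (activeGraph G x).ConnectedComponent =>
      univ.filter fun a : Fin n => a ∈ c.supp ∧ a ∈ active x) ?_ ?_ ?_
  · intro c _ a b ha hab
    rw [mem_filter] at ha ⊢
    exact ⟨mem_univ b, (c.mem_supp_congr_adj hab).1 ha.2.1,
      mem_active.2 ((activeGraph_adj G).1 hab).2.2⟩
  · intro c _ c' _ hne
    refine disjoint_left.2 fun a ha ha' => hne ?_
    rw [mem_filter, SimpleGraph.ConnectedComponent.mem_supp_iff] at ha ha'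
    exact ha.2.1.symm.trans ha'.2.1
  · ext a
    simp only [mem_biUnion, mem_univ, true_and, mem_filter]
    exact ⟨fun ⟨_, _, ha⟩ => ha,
      fun ha => ⟨(activeGraph G x).connectedComponentMk a, rfl, ha⟩⟩

end Summit.QuantumAdvantage.Dequantization.GraphStateRotationCorrelators

end
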